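import Mathlib
import Summits.NavierStokesRegularity.NavierStokesRegularity.Theorems.FilamentSkeletonRssClause13SmoothingKernelMoment
import Summits.NavierStokesRegularity.NavierStokesRegularity.Theorems.FilamentSkeletonRssClause13SmoothingKernelFourier

/-!
# Clause 13-J, brick B5 (band virial, symbol side): the COMMUTATOR SYMBOL `𝓕(x·K_q)(ξ) = −(2i/√q)·𝔖′(2πξ√q)`

Route `FilamentSkeletonRss`, child `Clause13NearStraightL` (stmt-NavierStokesRegularity-23321; typing-agnostic); design of record
`filament-plan/DESIGN-NOTE-28296-tenure-g22.md` §4: the virial identity's gain term is `−G·⟨Y, 𝔖′(μD)Y⟩`, i.e. the multiplier of the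
commutator kernel `(τ−σ)K_q(τ−σ)` (physical side: `…Clause13KernelVirial`, p670953) is the DERIVATIVE OF THE SYMBOL.  From
`𝓕K_q(ξ) = (2/q)(1 − 𝔖(2πξ√q))` (p664709), `𝔖` differentiable and `𝓕(x·K_q) = (i/2π)(𝓕K_q)′` (p671805):

  `(𝓕K_q)′(ξ) = −(2/q)·2π√q·𝔖′(2πξ√q)`,   `𝓕(x ↦ x·K_q(x))(ξ) = −(2i/√q)·𝔖′(2πξ√q)`.

Lane ns-filament-19175-p1 g14; `--supports stmt-NavierStokesRegularity-23321 --as helper`.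
HONEST FRAMING: harmonic analysis of an explicit model kernel attached to a HYPOTHETICAL filament skeleton on the NEGATIVE side of a MODEL
route; nothing here bears on Navier–Stokes regularity or blow-up.
-/

noncomputable section

open MeasureTheory Real Complex Filter Set
open scoped FourierTransform
open Summit.NavierStokesRegularity.NavierStokesRegularity.Theorems.AnalyticStripLiaSymbol (liaSym)

namespace Summit.NavierStokesRegularity.NavierStokesRegularity.Theorems.MatchedKernel
set_option linter.dupNamespace false

/-- **Explicit derivative of the multiplier**: `(𝓕K_q)′(ξ) = −(2/q)·(2π√q)·𝔖′(2πξ√q)`. [folklore] -/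
theorem hasDerivAt_fourier_smoothingKernel_explicit {q : ℝ} (hq : 0 < q) (ξ : ℝ) :
    HasDerivAt (𝓕 (fun s : ℝ => (((2 * q - s ^ 2) * ((s ^ 2 + q) ^ (5 / 2 : ℝ))⁻¹ : ℝ) : ℂ)))
      (((-(2 / q) * (2 * π * √q) * deriv liaSym (2 * π * ξ * √q) : ℝ) : ℂ)) ξ := by
  have hfun : 𝓕 (fun s : ℝ => (((2 * q - s ^ 2) * ((s ^ 2 + q) ^ (5 / 2 : ℝ))⁻¹ : ℝ) : ℂ))
      = fun ξ : ℝ => (((2 / q * (1 - liaSym (2 * π * ξ * √q))) : ℝ) : ℂ) := by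
    funext ξ; exact fourier_smoothingKernel hq ξ
  rw [hfun]
  have hin : HasDerivAt (fun ξ : ℝ => 2 * π * ξ * √q) (2 * π * √q) ξ := by
    have h := ((hasDerivAt_id ξ).const_mul (2 * π)).mul_const (√q)
    simpa using h
  have hS : HasDerivAt liaSym (deriv liaSym (2 * π * ξ * √q)) (2 * π * ξ * √q) :=
    (differentiable_liaSym _).hasDerivAt
  have hcomp : HasDerivAt (fun ξ : ℝ => liaSym (2 * π * ξ * √q)) (deriv liaSym (2 * π * ξ * √q) * (2 * π * √q)) ξ := by
    have h : HasDerivAt (liaSym ∘ fun ξ : ℝ => 2 * π * ξ * √q) (deriv liaSym (2 * π * ξ * √q) * (2 * π * √q)) ξ :=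
      hS.comp ξ hin
    exact h
  have hreal : HasDerivAt (fun ξ : ℝ => 2 / q * (1 - liaSym (2 * π * ξ * √q)))
      (-(2 / q) * (2 * π * √q) * deriv liaSym (2 * π * ξ * √q)) ξ := by
    have h := (hcomp.const_sub 1).const_mul (2 / q)
    refine h.congr_deriv ?_
    ring
  exact hreal.ofReal_comp

/-- `deriv (𝓕K_q) ξ = −(2/q)·(2π√q)·𝔖′(2πξ√q)`. [folklore] -/
theorem deriv_fourier_smoothingKernel {q : ℝ} (hq : 0 < q) (ξ : ℝ) :
    deriv (𝓕 (fun s : ℝ => (((2 * q - s ^ 2) * ((s ^ 2 + q) ^ (5 / 2 : ℝ))⁻¹ : ℝ) : ℂ))) ξ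
      = (((-(2 / q) * (2 * π * √q) * deriv liaSym (2 * π * ξ * √q) : ℝ) : ℂ)) :=
  (hasDerivAt_fourier_smoothingKernel_explicit hq ξ).deriv

/-- **THE COMMUTATOR SYMBOL**: `𝓕(x ↦ x·K_q(x))(ξ) = −(2i/√q)·𝔖′(2πξ√q)` — the multiplier of the kernel `(τ−σ)K_q(τ−σ)` of
`[(τ−c), K_q∗]` is (a constant times) the derivative of the self-induction symbol. [folklore] -/
theorem fourier_mul_smoothingKernel_explicit {q : ℝ} (hq : 0 < q) (ξ : ℝ) :
    𝓕 (fun s : ℝ => (((s * ((2 * q - s ^ 2) * ((s ^ 2 + q) ^ (5 / 2 : ℝ))⁻¹) : ℝ)) : ℂ)) ξ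
      = -(2 / √q * deriv liaSym (2 * π * ξ * √q) : ℝ) * I := by
  rw [fourier_mul_smoothingKernel_eq_deriv hq, deriv_fourier_smoothingKernel hq]
  have hsq : (√q : ℂ) ≠ 0 := by exact_mod_cast (Real.sqrt_pos.2 hq).ne'
  have hq' : (q : ℂ) = (√q : ℂ) * (√q : ℂ) := by
    rw [← Complex.ofReal_mul, Real.mul_self_sqrt hq.le]
  have hπ : (π : ℂ) ≠ 0 := by exact_mod_cast Real.pi_ne_zero
  push_cast
  rw [hq']
  field_simp

end Summit.NavierStokesRegularity.NavierStokesRegularity.Theorems.MatchedKernel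

end
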